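import Literature.Barriers.AtomisticToContinuum.DisorderedHarmonicChainDensityUpperDefs
import Literature.Barriers.AtomisticToContinuum.DisorderedHarmonicChainVariationsRegularity
import Literature.Barriers.AtomisticToContinuum.DisorderedHarmonicChainMoments
import Literature.Barriers.AtomisticToContinuum.DisorderedHarmonicChainDensityCrude
import HarnessLib

/-!
# Ajanki–Huveneers 2011: pointwise bounds, regularity and the integration-by-parts identity for `Ψ_ε`

Part of the integration-by-parts route to the upper bound (5.1) of Prop. 5.1 of O. Ajanki,
F. Huveneers, CMP **301** (2011) 841–883, arXiv:1003.1076 (see `…DensityUpperDefs.lean`). PROVED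
here:

* deterministic bounds, on the cube and in the small regime, for the three first variations that
  make up `V Ψ_ε` (`abs_sum_vaW_mul_duDT_le`, `abs_sum_vaW_mul_vaDN_le`,
  `abs_sum_vaW_mul_duDU_le`): each is a martingale transform in the centred `B_i` (coefficients
  `h'(X_j)B_jJ_jN_j`, `B_i cos(2πX_i) J_iN_i`) plus terms controlled by `∑ J_i`, using
  `P_x/P = -4πδ cos 2πX + 𝒪(δ²)` (`abs_pcPx_div_add_le`) and `|P_δ/P| ≤ 6`;
* continuity on the open cube of `T`, `∂_kT`, `U`, `∂_kU`, `Ψ_ε`, `∂_kΨ_ε` (for the integrability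
  and the continuity hypotheses of the integration by parts);
* **the integration-by-parts identity summed over the coordinates**
  (`integral_sum_vaW_mul_duD_eq`): `∫ VΨ_ε dτ^{⊗(n+1)} = -∫ (∑_k a_k ℓ(B_k)) Ψ_ε dτ^{⊗(n+1)}`.

[cite: AjankiHuveneers2011, Prop. 5.1 eq. (5.1); Prop. 3.5 eqs. (3.19)-(3.21); folklore (Malliavin-type integration by parts)]
-/

noncomputable section

open Real MeasureTheory Set Filter Function Finset
open scoped ENNReal

namespace Literature.Barriers.AtomisticToContinuum.HeatConduction

/-! ### Elementary bounds on `N_j`, `a_kξ(B_k)` and the ratios `P_x/P`, `P_δ/P` -/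

section Elementary

variable {w x : ℝ} (B : ℕ → ℝ) {ξ : ℝ → ℝ}

/-- `0 ≤ N_j` for `ξ ≥ 0`. [folklore] -/
theorem vaN_nonneg (w x : ℝ) (hξ0 : ∀ b, 0 ≤ ξ b) (j : ℕ) : 0 ≤ vaN w x B ξ j :=
  Finset.sum_nonneg fun k _ => mul_nonneg (hξ0 _) (vaU_bounds w x B k).1

/-- `N_j ≤ 2j` for `ξ ≤ 1` (`u_k ∈ [0, 2]`). [folklore] -/
theorem vaN_le (w x : ℝ) (hξ1 : ∀ b, ξ b ≤ 1) (j : ℕ) : vaN w x B ξ j ≤ 2 * j := by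
  unfold vaN
  calc ∑ k ∈ Finset.range j, ξ (B k) * vaU w x B k ≤ ∑ k ∈ Finset.range j, (2 : ℝ) :=
        Finset.sum_le_sum fun k _ => by
          have := vaU_bounds w x B k
          calc ξ (B k) * vaU w x B k ≤ 1 * 2 := mul_le_mul (hξ1 _) this.2 this.1 zero_le_one
            _ = 2 := by ring
    _ = 2 * j := by rw [Finset.sum_const, Finset.card_range, nsmul_eq_mul, mul_comm]

/-- `N_j ≤ N_{j'}` for `j ≤ j'` (`ξ ≥ 0`). [folklore] -/
theorem vaN_mono (w x : ℝ) (hξ0 : ∀ b, 0 ≤ ξ b) {j j' : ℕ} (hjj' : j ≤ j') :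
    vaN w x B ξ j ≤ vaN w x B ξ j' :=
  Finset.sum_le_sum_of_subset_of_nonneg (Finset.range_subset_range.mpr hjj')
    fun k _ _ => mul_nonneg (hξ0 _) (vaU_bounds w x B k).1

/-- `|a_k ξ(B_k)| ≤ π J_k / c(w)` for `0 ≤ ξ ≤ 1`. [folklore] -/
theorem abs_vaW_le (hw0 : 0 < w) (hw : π * w / 2 < 1) (hξ0 : ∀ b, 0 ≤ ξ b) (hξ1 : ∀ b, ξ b ≤ 1)
    (k : ℕ) : |vaW w x B ξ k| ≤ π * vaJ w x B k / igC w := by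
  unfold vaW
  have ha := vaA_pos (x := x) (B := B) hw0 hw k
  rw [abs_mul, abs_of_pos ha, abs_of_nonneg (hξ0 _)]
  calc vaA w x B k * ξ (B k) ≤ vaA w x B k * 1 := mul_le_mul_of_nonneg_left (hξ1 _) ha.le
    _ = π * vaJ w x B k / igC w := by unfold vaA; ring

/-- `wπ/c(w) ≤ 2`. [folklore] -/
theorem w_mul_pi_div_igC_le (hw0 : 0 < w) (hw : π * w / 2 < 1) : w * π / igC w ≤ 2 := by
  have hc := igC_pos hw0 hw
  rw [div_le_iff₀ hc]
  have := le_igC hw0.le hw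
  linarith

/-- **`P_x/P = -4πδ cos 2πy + 𝒪(δ²)`**: `|P_x(y,δ)/P(y,δ) + 4πδ cos 2πy| ≤ 28π δ²` for `|δ| ≤ 1/8`.
[cite: AjankiHuveneers2011, Prop. 3.5 eqs. (3.19)-(3.21)] -/
theorem abs_pcPx_div_add_le {δ : ℝ} (hδ : |δ| ≤ 1 / 8) (y : ℝ) :
    |pcPx y δ / pcP y δ + 4 * π * δ * Real.cos (2 * π * y)| ≤ 28 * π * δ ^ 2 := by
  obtain ⟨hPlo, hPhi⟩ := pcP_bounds (by linarith : |δ| ≤ 1 / 4) y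
  have hP0 : 0 < pcP y δ := by linarith
  have h1 := abs_pcPx_add_le y δ
  have hPm1 : |pcP y δ - 1| ≤ 5 / 2 * |δ| := by
    have hs := Real.abs_sin_le_one (2 * π * y)
    have hc1 : 0 ≤ 1 - Real.cos (2 * π * y) := by linarith [Real.cos_le_one (2 * π * y)]
    have hc2 : 1 - Real.cos (2 * π * y) ≤ 2 := by linarith [Real.neg_one_le_cos (2 * π * y)]
    have he : pcP y δ - 1 = -(2 * δ * Real.sin (2 * π * y)) + 2 * δ ^ 2 * (1 - Real.cos (2 * π * y)) := by
      unfold pcP; ring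
    have e1 : |-(2 * δ * Real.sin (2 * π * y))| ≤ 2 * |δ| := by
      rw [abs_neg, abs_mul, abs_mul, abs_two]
      calc 2 * |δ| * |Real.sin (2 * π * y)| ≤ 2 * |δ| * 1 := by gcongr
        _ = 2 * |δ| := mul_one _
    have e2 : |2 * δ ^ 2 * (1 - Real.cos (2 * π * y))| ≤ 4 * δ ^ 2 := by
      rw [abs_mul, abs_of_nonneg (by positivity : (0:ℝ) ≤ 2 * δ ^ 2), abs_of_nonneg hc1]
      nlinarith [sq_nonneg δ]
    rw [he]
    refine (abs_add_le _ _).trans ?_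
    have : 4 * δ ^ 2 ≤ 1 / 2 * |δ| := by rw [← sq_abs]; nlinarith [abs_nonneg δ]
    linarith
  have hnum : pcPx y δ / pcP y δ + 4 * π * δ * Real.cos (2 * π * y) =
      (pcPx y δ + 4 * π * δ * Real.cos (2 * π * y) + 4 * π * δ * Real.cos (2 * π * y) * (pcP y δ - 1)) /
        pcP y δ := by
    field_simp; ring
  rw [hnum, abs_div, abs_of_pos hP0, div_le_iff₀ hP0]
  have hcos := Real.abs_cos_le_one (2 * π * y)
  calc |pcPx y δ + 4 * π * δ * Real.cos (2 * π * y) + 4 * π * δ * Real.cos (2 * π * y) * (pcP y δ - 1)|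
      ≤ |pcPx y δ + 4 * π * δ * Real.cos (2 * π * y)| + |4 * π * δ * Real.cos (2 * π * y) * (pcP y δ - 1)| :=
        abs_add_le _ _
    _ ≤ 4 * π * δ ^ 2 + 4 * π * |δ| * 1 * (5 / 2 * |δ|) := by
        refine add_le_add h1 ?_
        rw [abs_mul, abs_mul, abs_mul, abs_mul, abs_of_pos Real.pi_pos, abs_of_pos (by norm_num : (0:ℝ) < 4)]
        gcongr
    _ = 14 * π * δ ^ 2 := by rw [← sq_abs δ]; ring
    _ ≤ 28 * π * δ ^ 2 * pcP y δ := by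
        nlinarith [mul_le_mul_of_nonneg_left hPlo (by positivity : 0 ≤ 28 * π * δ ^ 2)]

/-- `|P_δ/P| ≤ 6` for `|δ| ≤ 1/8`. [folklore] -/
theorem abs_pcPd_div_le {δ : ℝ} (hδ : |δ| ≤ 1 / 8) (y : ℝ) : |pcPd y δ / pcP y δ| ≤ 6 := by
  obtain ⟨hPlo, -⟩ := pcP_bounds (by linarith : |δ| ≤ 1 / 4) y
  have hP0 : 0 < pcP y δ := by linarith
  rw [abs_div, abs_of_pos hP0, div_le_iff₀ hP0]
  have := abs_pcPd_le y δ
  nlinarith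

end Elementary

/-! ### Pointwise bounds on the first variations entering `V Ψ_ε` -/

section Pointwise

variable {w x M : ℝ} {h ξ : ℝ → ℝ} (B : ℕ → ℝ)

/-- **`|V T_n| ≤ w |∑ h'(X_j)B_jJ_jN_j| + 2 sup|h| ∑ J_k`.** [folklore] -/
theorem abs_sum_vaW_mul_duDT_le (hw0 : 0 < w) (hw : π * w / 2 < 1) (hξ0 : ∀ b, 0 ≤ ξ b)
    (hξ1 : ∀ b, ξ b ≤ 1) {H : ℝ} (hH : ∀ y, |h y| ≤ H) {m n : ℕ} (hnm : n ≤ m) :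
    |∑ k ∈ Finset.range m, vaW w x B ξ k * duDT w x h B n k| ≤
      w * |∑ j ∈ Finset.range n, deriv h (ahPhase w x B j) * B j * (vaJ w x B j * vaN w x B ξ j)| +
        2 * H * ∑ k ∈ Finset.range n, vaJ w x B k := by
  rw [sum_vaW_mul_duDT h B hw0 hw ξ hnm, abs_mul, abs_of_pos hw0]
  set A := ∑ j ∈ Finset.range n, deriv h (ahPhase w x B j) * B j * (vaJ w x B j * vaN w x B ξ j) with hA
  set Sm := ∑ k ∈ Finset.range n, vaW w x B ξ k * h (ahPhase w x B k) with hSm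
  have hH0 : 0 ≤ H := (abs_nonneg _).trans (hH 0)
  have hc := igC_pos hw0 hw
  have hS : w * |Sm| ≤ 2 * H * ∑ k ∈ Finset.range n, vaJ w x B k := by
    have h1 : |Sm| ≤ ∑ k ∈ Finset.range n, π * vaJ w x B k / igC w * H := by
      refine (Finset.abs_sum_le_sum_abs _ _).trans (Finset.sum_le_sum fun k _ => ?_)
      rw [abs_mul]
      have hJ := vaJ_pos w x B k
      exact mul_le_mul (abs_vaW_le B hw0 hw hξ0 hξ1 k) (hH _) (abs_nonneg _) (by positivity)
    have h2 : w * ∑ k ∈ Finset.range n, π * vaJ w x B k / igC w * H =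
        (w * π / igC w) * (H * ∑ k ∈ Finset.range n, vaJ w x B k) := by
      rw [Finset.mul_sum, Finset.mul_sum, Finset.mul_sum]
      exact Finset.sum_congr rfl fun k _ => by field_simp
    have h3 := w_mul_pi_div_igC_le hw0 hw
    have hJ0 : 0 ≤ ∑ k ∈ Finset.range n, vaJ w x B k := Finset.sum_nonneg fun k _ => (vaJ_pos w x B k).le
    calc w * |Sm| ≤ w * ∑ k ∈ Finset.range n, π * vaJ w x B k / igC w * H :=
          mul_le_mul_of_nonneg_left h1 hw0.le
      _ = (w * π / igC w) * (H * ∑ k ∈ Finset.range n, vaJ w x B k) := h2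
      _ ≤ 2 * (H * ∑ k ∈ Finset.range n, vaJ w x B k) :=
          mul_le_mul_of_nonneg_right h3 (mul_nonneg hH0 hJ0)
      _ = 2 * H * ∑ k ∈ Finset.range n, vaJ w x B k := by ring
  calc w * |A + Sm| ≤ w * (|A| + |Sm|) := mul_le_mul_of_nonneg_left (abs_add_le _ _) hw0.le
    _ = w * |A| + w * |Sm| := by ring
    _ ≤ w * |A| + 2 * H * ∑ k ∈ Finset.range n, vaJ w x B k := by linarith [hS]

/-- **`|V N_j| ≤ (2π sup|ξ'|/c(w)) ∑_{k<j} J_k + 4π ∑_{i<j} i J_i`.** [folklore] -/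
theorem abs_sum_vaW_mul_vaDN_le (hw0 : 0 < w) (hw : π * w / 2 < 1) (hξ0 : ∀ b, 0 ≤ ξ b)
    (hξ1 : ∀ b, ξ b ≤ 1) {Ξ : ℝ} (hΞ : ∀ b, |deriv ξ b| ≤ Ξ) {m j : ℕ} (hjm : j ≤ m) :
    |∑ k ∈ Finset.range m, vaW w x B ξ k * vaDN w x B ξ k j| ≤
      2 * π * Ξ / igC w * ∑ k ∈ Finset.range j, vaJ w x B k +
        4 * π * ∑ i ∈ Finset.range j, (i : ℝ) * vaJ w x B i := by
  rw [sum_vaW_mul_vaDN B hw0 hw ξ hjm]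
  have hc := igC_pos hw0 hw
  have hΞ0 : 0 ≤ Ξ := (abs_nonneg _).trans (hΞ 0)
  refine (abs_add_le _ _).trans (add_le_add ?_ ?_)
  · rw [Finset.mul_sum]
    refine (Finset.abs_sum_le_sum_abs _ _).trans (Finset.sum_le_sum fun k _ => ?_)
    have hu := vaU_bounds w x B k
    have hJ := vaJ_pos w x B k
    rw [abs_mul, abs_mul, abs_of_nonneg hu.1]
    calc |vaW w x B ξ k| * (|deriv ξ (B k)| * vaU w x B k)
        ≤ (π * vaJ w x B k / igC w) * (Ξ * 2) :=
          mul_le_mul (abs_vaW_le B hw0 hw hξ0 hξ1 k) (mul_le_mul (hΞ _) hu.2 hu.1 hΞ0)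
            (mul_nonneg (abs_nonneg _) hu.1) (by positivity)
      _ = 2 * π * Ξ / igC w * vaJ w x B k := by field_simp
  · rw [Finset.mul_sum]
    refine (Finset.abs_sum_le_sum_abs _ _).trans (Finset.sum_le_sum fun i _ => ?_)
    have hJ := vaJ_pos w x B i
    have hN0 := vaN_nonneg B w x hξ0 i
    have hN := vaN_le B w x hξ1 i
    have hs := Real.abs_sin_le_one (2 * π * ahPhase w x B i)
    have e1 : |ξ (B i)| ≤ 1 := by rw [abs_of_nonneg (hξ0 _)]; exact hξ1 _
    have e2 : |2 * π * Real.sin (2 * π * ahPhase w x B i)| ≤ 2 * π := by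
      rw [abs_mul, abs_of_pos Real.two_pi_pos]
      calc 2 * π * |Real.sin (2 * π * ahPhase w x B i)| ≤ 2 * π * 1 := by gcongr
        _ = 2 * π := mul_one _
    have e3 : |vaJ w x B i * vaN w x B ξ i| ≤ vaJ w x B i * (2 * i) := by
      rw [abs_mul, abs_of_pos hJ, abs_of_nonneg hN0]
      exact mul_le_mul_of_nonneg_left hN hJ.le
    rw [abs_mul, abs_mul]
    calc |ξ (B i)| * |2 * π * Real.sin (2 * π * ahPhase w x B i)| * |vaJ w x B i * vaN w x B ξ i|
        ≤ 1 * (2 * π) * (vaJ w x B i * (2 * i)) :=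
          mul_le_mul (mul_le_mul e1 e2 (abs_nonneg _) zero_le_one) e3 (abs_nonneg _) (by positivity)
      _ = 4 * π * (i * vaJ w x B i) := by ring

/-- **`|V U_m| ≤ J_m {(4πc(w)|M₂| + (56π c(w)²M² m + 6π) ∑J_i) N_m + |VN_m|-majorant}`**, with the
martingale transform `M₂ = ∑_{i<m} B_i cos(2πX_i) J_iN_i`, in the small regime (`|B_i| ≤ M`,
`w ≤ w_pc(M)`). [folklore] -/
theorem abs_sum_vaW_mul_duDU_le (hM : 0 ≤ M) (hw0 : 0 < w) (hw : w ≤ pcW M) (hB : ∀ i, |B i| ≤ M)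
    (hξ0 : ∀ b, 0 ≤ ξ b) (hξ1 : ∀ b, ξ b ≤ 1) {Ξ : ℝ} (hΞ : ∀ b, |deriv ξ b| ≤ Ξ) (m : ℕ) :
    |∑ k ∈ Finset.range m, vaW w x B ξ k * duDU w x B ξ m k| ≤
      vaJ w x B m *
        ((4 * π * igC w *
            |∑ i ∈ Finset.range m, B i * Real.cos (2 * π * ahPhase w x B i) * (vaJ w x B i * vaN w x B ξ i)| +
            (56 * π * igC w ^ 2 * M ^ 2 * m + 6 * π) * ∑ i ∈ Finset.range m, vaJ w x B i) * vaN w x B ξ m +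
          (2 * π * Ξ / igC w * ∑ k ∈ Finset.range m, vaJ w x B k +
            4 * π * ∑ i ∈ Finset.range m, (i : ℝ) * vaJ w x B i)) := by
  obtain ⟨hw2, -, -⟩ := pc_small hM hw0.le hw (hB 0)
  have hwπ : π * w / 2 < 1 := by linarith
  rw [sum_vaW_mul_duDU B hw0 hwπ ξ m, abs_mul, abs_of_pos (vaJ_pos w x B m)]
  refine mul_le_mul_of_nonneg_left ?_ (vaJ_pos w x B m).le
  have hN0 := vaN_nonneg B w x hξ0 m
  have hVN := abs_sum_vaW_mul_vaDN_le (x := x) B hw0 hwπ hξ0 hξ1 hΞ (le_refl m)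
  rw [sum_vaW_mul_vaDN B hw0 hwπ ξ le_rfl] at hVN
  refine (abs_add_le _ _).trans (add_le_add ?_ hVN)
  rw [abs_mul, abs_of_nonneg hN0, abs_neg]
  refine mul_le_mul_of_nonneg_right ?_ hN0
  -- the two ratio sums
  set ρx : ℕ → ℝ := fun i => pcPx (ahPhase w x B i) (igDelta w (B i)) / vaP w x B i with hρx
  set ρd : ℕ → ℝ := fun i => pcPd (ahPhase w x B i) (igDelta w (B i)) / vaP w x B i with hρd
  have hsplit : ∑ i ∈ Finset.range m,
      (pcPx (ahPhase w x B i) (igDelta w (B i)) * (vaJ w x B i * vaN w x B ξ i) +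
        pcPd (ahPhase w x B i) (igDelta w (B i)) * (π * vaJ w x B i) * ξ (B i)) / vaP w x B i =
      ∑ i ∈ Finset.range m, ρx i * (vaJ w x B i * vaN w x B ξ i) +
        ∑ i ∈ Finset.range m, ρd i * (π * vaJ w x B i) * ξ (B i) := by
    rw [← Finset.sum_add_distrib]
    refine Finset.sum_congr rfl fun i _ => ?_
    simp only [hρx, hρd]
    have := (vaP_pos w x B i).ne'
    field_simp
  rw [hsplit]
  have hδ : ∀ i, |igDelta w (B i)| ≤ 1 / 8 := fun i => (pc_small hM hw0.le hw (hB i)).2.2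
  have hvaP : ∀ i, vaP w x B i = pcP (ahPhase w x B i) (igDelta w (B i)) := fun i => rfl
  -- the `P_x/P` sum: martingale part plus `𝒪(δ²)`
  have hx : |∑ i ∈ Finset.range m, ρx i * (vaJ w x B i * vaN w x B ξ i)| ≤
      4 * π * igC w *
          |∑ i ∈ Finset.range m, B i * Real.cos (2 * π * ahPhase w x B i) * (vaJ w x B i * vaN w x B ξ i)| +
        56 * π * igC w ^ 2 * M ^ 2 * m * ∑ i ∈ Finset.range m, vaJ w x B i := by
    set r : ℕ → ℝ := fun i => ρx i + 4 * π * igDelta w (B i) * Real.cos (2 * π * ahPhase w x B i) with hr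
    have hr_le : ∀ i, |r i| ≤ 28 * π * (igDelta w (B i)) ^ 2 := fun i => by
      simp only [hr, hρx, hvaP]; exact abs_pcPx_div_add_le (hδ i) _
    have hdec : ∑ i ∈ Finset.range m, ρx i * (vaJ w x B i * vaN w x B ξ i) =
        -(4 * π * igC w) *
            ∑ i ∈ Finset.range m, B i * Real.cos (2 * π * ahPhase w x B i) * (vaJ w x B i * vaN w x B ξ i) +
          ∑ i ∈ Finset.range m, r i * (vaJ w x B i * vaN w x B ξ i) := by
      rw [Finset.mul_sum, ← Finset.sum_add_distrib]
      refine Finset.sum_congr rfl fun i _ => ?_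
      simp only [hr]; unfold igDelta; ring
    rw [hdec]
    refine (abs_add_le _ _).trans (add_le_add ?_ ?_)
    · have hc0 : 0 ≤ 4 * π * igC w := by have := igC_pos hw0 hwπ; positivity
      rw [abs_mul, abs_neg, abs_of_nonneg hc0]
    · refine (Finset.abs_sum_le_sum_abs _ _).trans ?_
      rw [Finset.mul_sum]
      refine Finset.sum_le_sum fun i hi => ?_
      have hi' : (i : ℝ) ≤ m := by exact_mod_cast (Finset.mem_range.mp hi).le
      have hJ := vaJ_pos w x B i
      have hN0 := vaN_nonneg B w x hξ0 i
      have hN := vaN_le B w x hξ1 i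
      have hδ2 : igDelta w (B i) ^ 2 ≤ igC w ^ 2 * M ^ 2 := by
        unfold igDelta
        rw [mul_pow]
        refine mul_le_mul_of_nonneg_left ?_ (sq_nonneg _)
        rw [← sq_abs (B i)]
        exact pow_le_pow_left₀ (abs_nonneg _) (hB i) 2
      rw [abs_mul, abs_mul, abs_of_pos hJ, abs_of_nonneg hN0]
      calc |r i| * (vaJ w x B i * vaN w x B ξ i) ≤ 28 * π * (igC w ^ 2 * M ^ 2) * (vaJ w x B i * (2 * m)) := by
            refine mul_le_mul ((hr_le i).trans (by gcongr)) ?_ (by positivity) (by positivity)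
            exact mul_le_mul_of_nonneg_left (hN.trans (by linarith)) hJ.le
        _ = 56 * π * igC w ^ 2 * M ^ 2 * m * vaJ w x B i := by ring
  -- the `P_δ/P` sum
  have hd : |∑ i ∈ Finset.range m, ρd i * (π * vaJ w x B i) * ξ (B i)| ≤ 6 * π * ∑ i ∈ Finset.range m, vaJ w x B i := by
    refine (Finset.abs_sum_le_sum_abs _ _).trans ?_
    rw [Finset.mul_sum]
    refine Finset.sum_le_sum fun i _ => ?_
    have hJ := vaJ_pos w x B i
    have hρ : |ρd i| ≤ 6 := by simp only [hρd, hvaP]; exact abs_pcPd_div_le (hδ i) _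
    rw [abs_mul, abs_mul, abs_of_nonneg (hξ0 _), abs_mul, abs_of_pos Real.pi_pos, abs_of_pos hJ]
    calc |ρd i| * (π * vaJ w x B i) * ξ (B i) ≤ 6 * (π * vaJ w x B i) * 1 :=
          mul_le_mul (mul_le_mul_of_nonneg_right hρ (by positivity)) (hξ1 _) (hξ0 _) (by positivity)
      _ = 6 * π * vaJ w x B i := by ring
  calc |∑ i ∈ Finset.range m, ρx i * (vaJ w x B i * vaN w x B ξ i) +
          ∑ i ∈ Finset.range m, ρd i * (π * vaJ w x B i) * ξ (B i)|
      ≤ |∑ i ∈ Finset.range m, ρx i * (vaJ w x B i * vaN w x B ξ i)| +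
          |∑ i ∈ Finset.range m, ρd i * (π * vaJ w x B i) * ξ (B i)| := abs_add_le _ _
    _ ≤ _ := by nlinarith [hx, hd]

end Pointwise

/-! ### Continuity on the open cube -/

section Continuity

variable {w x R : ℝ} {n : ℕ} {h ξ G g : ℝ → ℝ}

-- keep the unifier from unfolding the trigonometric polynomials and the chain (expensive `whnf`)
attribute [local irreducible] pcP pcPx pcPd ahPhase igDelta

/-- `b ↦ T_j(b)` is continuous on the open cube (`h` continuous). [folklore] -/
theorem continuousOn_duT_pi (hR : 0 < R) (hw0 : 0 ≤ w) (hw : w ≤ pcW R) (x : ℝ) (hh : Continuous h)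
    (j : ℕ) :
    ContinuousOn (fun b : Fin n → ℝ => duT w x h (finExt b) j) (Set.pi Set.univ fun _ : Fin n => Set.Ioo (-R) R) := by
  unfold duT
  refine continuousOn_const.mul (continuousOn_finsetSum _ fun i _ => ?_)
  exact (hh.comp_continuousOn (continuousOn_ahPhase_pi hR hw0 hw x i)).mul (continuous_finExt i).continuousOn

/-- `b ↦ ∂_kT_j(b)` is continuous on the open cube (`h ∈ C¹`). [folklore] -/
theorem continuousOn_duDT_pi (hR : 0 < R) (hw0 : 0 ≤ w) (hw : w ≤ pcW R) (x : ℝ) (hh : Continuous h)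
    (hh' : Continuous (deriv h)) (j k : ℕ) :
    ContinuousOn (fun b : Fin n → ℝ => duDT w x h (finExt b) j k) (Set.pi Set.univ fun _ : Fin n => Set.Ioo (-R) R) := by
  unfold duDT
  refine continuousOn_const.mul (continuousOn_finsetSum _ fun i _ => ?_)
  refine ContinuousOn.add ?_ ?_
  · exact (((hh'.comp_continuousOn (continuousOn_ahPhase_pi hR hw0 hw x i)).mul
      (continuousOn_vaDX_pi hR hw0 hw x k i)).mul (continuous_finExt i).continuousOn)
  · by_cases hik : i = k
    · simp only [hik, ↓reduceIte]
      exact hh.comp_continuousOn (continuousOn_ahPhase_pi hR hw0 hw x k)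
    · simp only [hik, ↓reduceIte]; exact continuousOn_const

/-- `b ↦ U_j(b)` is continuous on the open cube (`ξ` continuous). [folklore] -/
theorem continuousOn_duU_pi (hR : 0 < R) (hw0 : 0 ≤ w) (hw : w ≤ pcW R) (x : ℝ) (hξ : Continuous ξ) (j : ℕ) :
    ContinuousOn (fun b : Fin n → ℝ => duU w x (finExt b) ξ j) (Set.pi Set.univ fun _ : Fin n => Set.Ioo (-R) R) := by
  unfold duU
  exact (continuousOn_vaJ_pi hR hw0 hw x j).mul (continuousOn_vaN_pi hR hw0 hw x hξ j)

/-- `b ↦ ∂_kU_j(b)` is continuous on the open cube (`ξ ∈ C¹`). [folklore] -/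
theorem continuousOn_duDU_pi (hR : 0 < R) (hw0 : 0 ≤ w) (hw : w ≤ pcW R) (x : ℝ) (hξ : Continuous ξ)
    (hξ' : Continuous (deriv ξ)) (j k : ℕ) :
    ContinuousOn (fun b : Fin n → ℝ => duDU w x (finExt b) ξ j k) (Set.pi Set.univ fun _ : Fin n => Set.Ioo (-R) R) := by
  unfold duDU
  exact ((continuousOn_vaDJ_pi hR hw0 hw x k j).mul (continuousOn_vaN_pi hR hw0 hw x hξ j)).add
    ((continuousOn_vaJ_pi hR hw0 hw x j).mul (continuousOn_vaDN_pi hR hw0 hw x hξ hξ' k j))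

/-- `U_j + ε > 0` for `ξ ≥ 0`, `ε > 0`. [folklore] -/
theorem duU_add_pos (w x : ℝ) (B : ℕ → ℝ) (hξ0 : ∀ b, 0 ≤ ξ b) {ε : ℝ} (hε : 0 < ε) (j : ℕ) :
    0 < duU w x B ξ j + ε :=
  lt_of_lt_of_le hε (le_add_of_nonneg_left (duU_nonneg w x B hξ0 j))

/-- `b ↦ Ψ_ε(b)` is continuous on the open cube. [folklore] -/
theorem continuousOn_duPsi_pi (hR : 0 < R) (hw0 : 0 ≤ w) (hw : w ≤ pcW R) (x : ℝ) (hh : Continuous h)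
    (hξ : Continuous ξ) (hξ0 : ∀ b, 0 ≤ ξ b) (hG : Continuous G) (j m₁ : ℕ) (L : ℝ) {ε : ℝ} (hε : 0 < ε) :
    ContinuousOn (fun b : Fin n → ℝ => duPsi w x h ξ G j m₁ L ε (finExt b))
      (Set.pi Set.univ fun _ : Fin n => Set.Ioo (-R) R) := by
  unfold duPsi
  refine (((hG.comp_continuousOn (continuousOn_ahPhase_pi hR hw0 hw x j)).mul
    (Real.continuous_exp.comp_continuousOn (continuousOn_duT_pi hR hw0 hw x hh j))).mul
    ((continuous_duChi L).comp_continuousOn (continuousOn_vaN_pi hR hw0 hw x hξ m₁))).mul ?_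
  exact ((continuousOn_duU_pi hR hw0 hw x hξ j).add continuousOn_const).inv₀
    fun b _ => (duU_add_pos w x _ hξ0 hε j).ne'

/-- `b ↦ ∂_kΨ_ε(b)` is continuous on the open cube. [folklore] -/
theorem continuousOn_duD_pi (hR : 0 < R) (hw0 : 0 ≤ w) (hw : w ≤ pcW R) (x : ℝ) (hh : Continuous h)
    (hh' : Continuous (deriv h)) (hξ : Continuous ξ) (hξ' : Continuous (deriv ξ)) (hξ0 : ∀ b, 0 ≤ ξ b)
    (hG : Continuous G) (hg : Continuous g) (j m₁ : ℕ) (L : ℝ) {ε : ℝ} (hε : 0 < ε) (k : ℕ) :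
    ContinuousOn (fun b : Fin n → ℝ => duD w x h ξ G j m₁ L ε (finExt b) g k)
      (Set.pi Set.univ fun _ : Fin n => Set.Ioo (-R) R) := by
  have hX := continuousOn_ahPhase_pi (n := n) hR hw0 hw x j
  have hE : ContinuousOn (fun b : Fin n → ℝ => Real.exp (duT w x h (finExt b) j))
      (Set.pi Set.univ fun _ : Fin n => Set.Ioo (-R) R) :=
    Real.continuous_exp.comp_continuousOn (continuousOn_duT_pi hR hw0 hw x hh j)
  have hN := continuousOn_vaN_pi (n := n) hR hw0 hw x hξ m₁
  have hχ : ContinuousOn (fun b : Fin n → ℝ => duChi L (vaN w x (finExt b) ξ m₁))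
      (Set.pi Set.univ fun _ : Fin n => Set.Ioo (-R) R) := (continuous_duChi L).comp_continuousOn hN
  have hχ' : ContinuousOn (fun b : Fin n → ℝ => duDChi L (vaN w x (finExt b) ξ m₁))
      (Set.pi Set.univ fun _ : Fin n => Set.Ioo (-R) R) := (continuous_duDChi L).comp_continuousOn hN
  have hUε : ContinuousOn (fun b : Fin n → ℝ => duU w x (finExt b) ξ j + ε)
      (Set.pi Set.univ fun _ : Fin n => Set.Ioo (-R) R) := (continuousOn_duU_pi hR hw0 hw x hξ j).add continuousOn_const
  have hUε0 : ∀ b ∈ (Set.pi Set.univ fun _ : Fin n => Set.Ioo (-R) R), duU w x (finExt b) ξ j + ε ≠ 0 :=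
    fun b _ => (duU_add_pos w x _ hξ0 hε j).ne'
  have hRi : ContinuousOn (fun b : Fin n → ℝ => (duU w x (finExt b) ξ j + ε)⁻¹)
      (Set.pi Set.univ fun _ : Fin n => Set.Ioo (-R) R) := hUε.inv₀ hUε0
  unfold duD
  refine ContinuousOn.add ?_ ?_
  · exact ((((hg.comp_continuousOn hX).mul (continuousOn_vaDX_pi hR hw0 hw x k j)).mul hE).mul hχ).mul hRi
  · refine (hG.comp_continuousOn hX).mul ((ContinuousOn.add (ContinuousOn.add ?_ ?_)) ?_)
    · exact ((hE.mul (continuousOn_duDT_pi hR hw0 hw x hh hh' j k)).mul hχ).mul hRi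
    · exact (hE.mul (hχ'.mul (continuousOn_vaDN_pi hR hw0 hw x hξ hξ' k m₁))).mul hRi
    · refine (hE.mul hχ).mul ?_
      exact (continuousOn_duDU_pi hR hw0 hw x hξ hξ' j k).neg.div (hUε.pow 2)
        fun b hb => pow_ne_zero 2 (hUε0 b hb)

end Continuity

/-! ### The integration-by-parts identity summed over the coordinates -/

section IBP

variable {τ : ℝ → ℝ} {bm bp : ℝ}

/-- `w_pc` is antitone. [folklore] -/
theorem pcW_antitone {M M' : ℝ} (hM : 0 ≤ M) (hMM' : M ≤ M') : pcW M' ≤ pcW M := by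
  unfold pcW
  exact one_div_le_one_div_of_le (by positivity) (by nlinarith [Real.pi_pos])

/-- Coordinates of an update of a cube point by `t ∈ [b₋, b₊]` stay in `[-b_*, b_*]`. [folklore] -/
theorem abs_finExt_update_le {n : ℕ} {b : Fin n → ℝ} (hb : ∀ i, bm ≤ b i ∧ b i ≤ bp) (k : Fin n)
    {t : ℝ} (ht : t ∈ Set.Icc bm bp) (i : ℕ) : |finExt (update b k t) i| ≤ max |bm| |bp| := by
  refine abs_finExt_le (fun i => ?_) i
  rcases eq_or_ne i k with rfl | hik
  · rw [update_self]; exact ht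
  · rw [update_of_ne hik]; exact hb i

/-- An update of a cube point by `t ∈ [b₋, b₊]` lies in the open cube of half-width `b_* + 1`.
[folklore] -/
theorem update_mem_openCube {n : ℕ} {b : Fin n → ℝ} (hb : ∀ i, bm ≤ b i ∧ b i ≤ bp) (k : Fin n)
    {t : ℝ} (ht : t ∈ Set.Icc bm bp) :
    update b k t ∈ Set.pi Set.univ fun _ : Fin n => Set.Ioo (-(max |bm| |bp| + 1)) (max |bm| |bp| + 1) := by
  refine mem_openCube_of_mem_cube fun i => ?_
  rcases eq_or_ne i k with rfl | hik
  · rw [update_self]; exact ht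
  · rw [update_of_ne hik]; exact hb i

/-- **The integration by parts, summed over the coordinates**:
`∫ ∑_k a_kξ(B_k) ∂_kΨ_ε dτ^{⊗(n+1)} = -∫ (∑_k a_k ℓ(B_k)) Ψ_ε dτ^{⊗(n+1)}` (`h, ξ ∈ C¹`, `G' = g`
continuous, `ε > 0`, small regime `w ≤ w_pc(b_* + 1)`). [folklore] -/
theorem integral_sum_vaW_mul_duD_eq (hτ : ReducedLawHyp τ bm bp) (S : SmoothingField τ bm bp)
    {ρB : Measure ℝ} [IsProbabilityMeasure ρB]
    (hρ : ρB = volume.withDensity fun s => ENNReal.ofReal (τ s))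
    {w x : ℝ} (hw0 : 0 < w) (hwR : w ≤ pcW (max |bm| |bp| + 1))
    {h G g : ℝ → ℝ} (hh : ContDiff ℝ 1 h) (hG : ∀ y, HasDerivAt G (g y) y) (hg : Continuous g)
    (n m₁ : ℕ) (L : ℝ) {ε : ℝ} (hε : 0 < ε) :
    ∫ b, ∑ k ∈ Finset.range (n + 1), vaW w x (finExt b) S.ξ k * duD w x h S.ξ G (n + 1) m₁ L ε (finExt b) g k
        ∂(Measure.pi fun _ : Fin (n + 1) => ρB) =
      -∫ b, (∑ k : Fin (n + 1), vaA w x (finExt b) k * S.ℓ (b k)) * duPsi w x h S.ξ G (n + 1) m₁ L ε (finExt b)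
        ∂(Measure.pi fun _ : Fin (n + 1) => ρB) := by
  set μ := (Measure.pi fun _ : Fin (n + 1) => ρB) with hμ
  set bstar : ℝ := max |bm| |bp| with hbstar
  set R : ℝ := bstar + 1 with hR
  have hbstar0 : 0 ≤ bstar := le_max_of_le_left (abs_nonneg _)
  have hR0 : 0 < R := by rw [hR]; linarith
  have hwb : w ≤ pcW bstar := hwR.trans (pcW_antitone hbstar0 (by rw [hR]; linarith))
  -- regularity data
  have hhc : Continuous h := hh.continuous
  have hhd : Differentiable ℝ h := hh.differentiable one_ne_zero
  have hh'c : Continuous (deriv h) := hh.continuous_deriv le_rfl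
  have hξc : Continuous S.ξ := S.ξ_contDiff.continuous
  have hξd : Differentiable ℝ S.ξ := S.ξ_contDiff.differentiable one_ne_zero
  have hξ'c : Continuous (deriv S.ξ) := S.ξ_contDiff.continuous_deriv le_rfl
  have hGc : Continuous G := continuous_iff_continuousAt.mpr fun y => (hG y).continuousAt
  set U : Set (Fin (n + 1) → ℝ) := Set.pi Set.univ fun _ : Fin (n + 1) => Set.Ioo (-R) R with hU
  -- the per-coordinate functionals
  set a : Fin (n + 1) → (Fin (n + 1) → ℝ) → ℝ := fun k b => vaA w x (finExt b) k with ha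
  set Ψ : (Fin (n + 1) → ℝ) → ℝ := fun b => duPsi w x h S.ξ G (n + 1) m₁ L ε (finExt b) with hΨ
  set D : Fin (n + 1) → (Fin (n + 1) → ℝ) → ℝ := fun k b => duD w x h S.ξ G (n + 1) m₁ L ε (finExt b) g k with hD
  have hΨc : ContinuousOn Ψ U := continuousOn_duPsi_pi hR0 hw0.le hwR x hhc hξc S.ξ_nonneg hGc (n + 1) m₁ L hε
  have hDc : ∀ k : Fin (n + 1), ContinuousOn (D k) U := fun k =>
    continuousOn_duD_pi hR0 hw0.le hwR x hhc hh'c hξc hξ'c S.ξ_nonneg hGc hg (n + 1) m₁ L hε k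
  have hac : ∀ k : Fin (n + 1), ContinuousOn (a k) U := fun k => continuousOn_vaA_pi hR0 hw0.le hwR x k
  -- per-coordinate integration by parts
  have hk : ∀ k : Fin (n + 1),
      Integrable (fun b => a k b * S.ξ (b k) * D k b) μ ∧ Integrable (fun b => a k b * S.ℓ (b k) * Ψ b) μ ∧
      ∫ b, a k b * S.ξ (b k) * D k b ∂μ = -∫ b, a k b * S.ℓ (b k) * Ψ b ∂μ := by
    intro k
    have hI1 : Integrable (fun b => a k b * S.ξ (b k) * D k b) μ := by
      refine (integrable_pi_of_continuousOn hτ hρ ?_).2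
      exact ((hac k).mul ((hξc.comp (continuous_apply k)).continuousOn)).mul (hDc k)
    have hI2 : Integrable (fun b => a k b * S.ℓ (b k) * Ψ b) μ := by
      obtain ⟨⟨C, hC⟩, hint⟩ := integrable_pi_of_continuousOn hτ hρ ((hac k).mul hΨc)
      have hℓ : Integrable (fun b : Fin (n + 1) → ℝ => S.ℓ (b k)) μ :=
        integrable_comp_eval (integrable_ell_sq hτ S hρ).2
      have := hℓ.bdd_mul hint.aestronglyMeasurable hC
      exact this.congr (ae_of_all _ fun b => by simp only [Pi.mul_apply]; ring)
    refine ⟨hI1, hI2, ?_⟩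
    refine pi_ibp_cube hτ S hρ k (a k) Ψ (D k) (fun b t => ?_) (fun b hb t ht => ?_) (fun b hb => ?_) hI1 hI2
    · simp only [ha]
      rw [finExt_update, vaA_update_of_le w x _ le_rfl]
    · simp only [hΨ, hD, finExt_update]
      have hB : ∀ i, |finExt b i| ≤ bstar := fun i => abs_finExt_le hb i
      exact hasDerivAt_duPsi_update' (x := x) hbstar0 hw0 hwb (finExt b) hB hhd hξd S.ξ_nonneg hG L hε
        (n + 1) m₁ k (ReducedLawHyp.abs_le_of_mem ht)
    · have hu : Continuous fun t : ℝ => update b k t := continuous_const.update k continuous_id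
      have hcomp : ContinuousOn (D k ∘ fun t => update b k t) (Set.Icc bm bp) :=
        (hDc k).comp hu.continuousOn fun t ht => update_mem_openCube hb k ht
      exact hcomp
  -- sum over the coordinates
  have hsumL : ∀ b : Fin (n + 1) → ℝ,
      ∑ k ∈ Finset.range (n + 1), vaW w x (finExt b) S.ξ k * duD w x h S.ξ G (n + 1) m₁ L ε (finExt b) g k =
        ∑ k : Fin (n + 1), a k b * S.ξ (b k) * D k b := by
    intro b
    rw [← Fin.sum_univ_eq_sum_range]
    refine Finset.sum_congr rfl fun k _ => ?_
    simp only [ha, hD, vaW, finExt_of_lt _ k.isLt]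
  have hsumR : ∀ b : Fin (n + 1) → ℝ,
      (∑ k : Fin (n + 1), vaA w x (finExt b) k * S.ℓ (b k)) * duPsi w x h S.ξ G (n + 1) m₁ L ε (finExt b) =
        ∑ k : Fin (n + 1), a k b * S.ℓ (b k) * Ψ b := by
    intro b
    rw [Finset.sum_mul]
  simp_rw [hsumL, hsumR]
  rw [integral_finsetSum _ fun k _ => (hk k).1, integral_finsetSum _ fun k _ => (hk k).2.1,
    ← Finset.sum_neg_distrib]
  exact Finset.sum_congr rfl fun k _ => (hk k).2.2

end IBP

end Literature.Barriers.AtomisticToContinuum.HeatConduction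

end
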